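import Mathlib
import HarnessLib
import Summits.Ventures.LatticeQCDFlow.Scaling.LatticeLaplaceHalfMass
import Summits.Ventures.LatticeQCDFlow.Scaling.LatticeEntropyU1
import Summits.Ventures.LatticeQCDFlow.Scaling.LatticeEntropyUN
import Summits.Ventures.LatticeQCDFlow.Scaling.LatticeEntropySUN
import Summits.Ventures.LatticeQCDFlow.Scaling.LatticeEntropySUNLaw

/-!
# LatticeQCDFlow / Scaling — the Laplace half-mass law (Gβ) for `U(1)`, `U(N)`, `SU(N)` with NO hypothesis

HONEST FRAMING: exact (Metropolis-corrected) sampling algorithms for lattice gauge theory; figures of merit are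
autocorrelation/cost numbers at stated couplings and volumes; no continuum-physics claim.

Venture `LatticeQCDFlow` (cell pub-lqcd), topic `Scaling`, FANOUT row 30 (lean-1) — OUR WORK.  `laplaceHalfMass`
(`Scaling/LatticeLaplaceHalfMass.lean`) proves the conjecture item `Conjectures.LaplaceHalfMass d N G ρ nTr` with
`nTr(L) = κ·((d-1)·L^d·(1 - 3/L) - 2)` from the one-plaquette inputs (H1)/(H2) with exponent `κ`.  Those inputs
are THEOREMS for `U(1)` (`κ = 1`, `LatticeEntropyU1`), `U(N)` (`κ = N²`, `LatticeEntropyUN`) and `SU(N)`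
(`κ = N² - 1`, `N ≥ 1`, `LatticeEntropySUNLaw`), so:

* `U1.laplaceHalfMass d`: `LaplaceHalfMass d 1 Circle u1Rep (fun L => 1·((d-1)·L^d·(1-3/L) - 2))`;
* `UN.laplaceHalfMass d N`:
  `LaplaceHalfMass d N U(N) unitaryFundamentalRep (fun L => N²·((d-1)·L^d·(1-3/L) - 2))`;
* `SUN.laplaceHalfMass d N` (`N ≥ 1`):
  `LaplaceHalfMass d N SU(N) fundamentalRep (fun L => (N²-1)·((d-1)·L^d·(1-3/L) - 2))` — for `SU(3)`, `d = 4`: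
  at every `β ≥ β₀` and every `L`, half of the Wilson law sits on a set of prior mass
  `≤ (c₀/β)^{12·L⁴·(1 - 3/L) - 8}`.

Elementary; nothing here is cited as a fact.
-/

noncomputable section

namespace Summit.Ventures.LatticeQCDFlow.Theory2.Lattice

open MeasureTheory Literature.MathematicalPhysics.QuantumFieldTheory
open Literature.MathematicalPhysics.QuantumLattice (u1Rep continuous_u1Rep unitaryFundamentalRep
  continuous_unitaryFundamentalRep fundamentalRep continuous_fundamentalRep)

/-- **(Gβ) for compact `U(1)` lattice gauge theory, unconditionally** (OURS):
`n_tr(L) = 1·((d-1)·L^d·(1-3/L) - 2)`. [folklore] -/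
theorem U1.laplaceHalfMass (d : ℕ) :
    Conjectures.LaplaceHalfMass d 1 Circle u1Rep
      (fun L => 1 * (((d : ℝ) - 1) * (L : ℝ) ^ d * (1 - 3 / L) - 2)) :=
  Lattice.laplaceHalfMass u1Rep d 1 continuous_u1Rep U1.re_trace_u1Rep_le
    ⟨Real.sqrt (Real.pi / 8), fun β hβ => by simpa using U1.onePlaquetteZ_u1Rep_le hβ⟩ U1.smallBall_u1

/-- **(Gβ) for `U(N)` lattice gauge theory, unconditionally** (OURS; every `N`):
`n_tr(L) = N²·((d-1)·L^d·(1-3/L) - 2)`. [folklore] -/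
theorem UN.laplaceHalfMass (d N : ℕ) :
    Conjectures.LaplaceHalfMass d N (Matrix.unitaryGroup (Fin N) ℂ) (unitaryFundamentalRep (Fin N) ℂ)
      (fun L => (N : ℝ) ^ 2 * (((d : ℝ) - 1) * (L : ℝ) ^ d * (1 - 3 / L) - 2)) :=
  Lattice.laplaceHalfMass (unitaryFundamentalRep (Fin N) ℂ) d ((N : ℝ) ^ 2)
    (continuous_unitaryFundamentalRep (Fin N) ℂ) UN.re_trace_le UN.onePlaquetteZ_un_le UN.smallBall_un

/-- **(Gβ) for `SU(N)` lattice gauge theory, unconditionally** (OURS; every `N ≥ 1`):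
`n_tr(L) = (N²-1)·((d-1)·L^d·(1-3/L) - 2)` — the sharp transverse count `(N²-1)(d-1)L^d` up to the `O(1/L)`
slack of the peeling bound.  Inputs: theory-2's `SUN.OnePlaquetteDecay`/`SUN.SmallBalls`, proved for all `N` in
`LatticeEntropySUNLaw` from the Haar volume of the action balls. [folklore] -/
theorem SUN.laplaceHalfMass (d N : ℕ) (hN : 1 ≤ N) :
    Conjectures.LaplaceHalfMass d N (Matrix.specialUnitaryGroup (Fin N) ℂ) (fundamentalRep (Fin N))
      (fun L => ((N : ℝ) ^ 2 - 1) * (((d : ℝ) - 1) * (L : ℝ) ^ d * (1 - 3 / L) - 2)) :=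
  Lattice.laplaceHalfMass (fundamentalRep (Fin N)) d ((N : ℝ) ^ 2 - 1) (continuous_fundamentalRep (Fin N))
    (SUN.re_trace_le N) (SUN.onePlaquetteDecay N hN) (SUN.smallBalls N hN)

end Summit.Ventures.LatticeQCDFlow.Theory2.Lattice

end
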